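import Mathlib

/-!
line stmt-HodgeConjecture-18881 Cruxes/BlochSeedDiscOne/Lines/birth.lean 814a6a70c14e831a stub_rung_pad4_seedAt

# UnipotentVisSerreFix — Serre duality in the letter calculus of record runs `h^q ↔ h^{8−q}` (the PAD-4 anchor is an
# EIGHTFOLD, `pad4Anchor_dim : dim = 2·4`), so the index of a non-degenerate difference class flips `pairDeg ↦ 8 − pairDeg`
# under `(p, ν) ↦ (ν, p)`; in particular `h²(D_{xp}) = h²(D_{px})` (UVIS-X2-monad4-g30 §2 (N2), which wrote «abelian
# fourfold») holds for NO non-degenerate visible pair: one side is `0`, the other is `pairDim ≠ 0`.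
(hsemireg-alphabet-unipotent-1 g31; claim-free; kit 0; record correction to the ×2 of LAW U-VIS only — the B2 charter is CLOSED,
director R19.662 (2) ∕ R19.667; nothing is recounted.)

KERNEL CONTENT — Mathlib-only COPY PLATE: `Letter ∕ Cell` = `DepthBoundA4.lean` dc428e4aa1c84517 ll. 59–63 ∕ 98 and `dn ∕ idx ∕ hdim ∕ pairDeg ∕ pairDim ∕
degKer` = `SigmaH.lean` fa42dde9550352c4 ll. 45–60 ∕ 106, copied VERBATIM (the importing version of this file is byte-for-byte the same below the
`open`s; the farm answered `remote:stale:7:unbuilt:…SigmaH` (rc 75) on it at 2026-08-31T01:3xZ, hence the copy):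
`dn_symm`, `idx_le_two`, `idx_symm` (one factor `E × E`, dim 2: `idx ν p = 2 − idx p ν` off the degenerate locus `dn = 0`),
`hdim_symm`, `pairDim_symm`, `pairDeg_le_eight`, `pairDeg_symm` (`pairDeg ν p = 8 − pairDeg p ν` for factorwise non-degenerate pairs),
`deg_two_iff_codeg_six`, `deg_one_iff_codeg_seven`, `deg_three_rev_iff_deg_five`, `not_deg_one_and_rev_three` ∕ `not_both_deg_two` (N2's two
identities `h³(D_{vu}) = h¹(D_{uv})`, `h²(D_{xp}) = h²(D_{px})` force both sides to vanish), `selfdual_deg_iff`; the digits `witness_deg ∕ witness_degKer`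
(`pairDeg = 2` one way, `6` the other, `pairDim = 81`) and `witness_path` (`5` along ∕ `3` reversed, `27`); §4 the corrected per-pair kernels
`n1Mass = degKer 2 + degKer 6`, `pathMass = degKer 1 + degKer 5` with `printed_N1_term ∕ printed_path_term` (the PRINTED U-VIS terms are these),
`msharp_le_*` and `doubling_fails` (UVIS-X2's `2·M♯` does not dominate them).
NOTHING here is proved toward HC ∕ HC_CM ∕ HC_AV ∕ №4 ∕ 26512 ∕ 18881 ∕ H2; letter arithmetic ≠ sheaves ≠ SEED; `Nonex 14 199 8` stays REFUTED as typed.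
No `instance`, no notation, no `axiom`, no `native_decide`, no `set_option` beyond the two linters below.
-/

set_option linter.dupNamespace false
set_option autoImplicit false

namespace Summit.HodgeConjecture.HodgeConjecture.Cruxes.BlochSeedDiscOne.UnipotentVisSerreFix

/-! ## §0 Verbatim copies (tree `DepthBoundA4.lean` dc428e4aa1c84517, `SigmaH.lean` fa42dde9550352c4) -/

/-- A letter on one factor: the class `a·h + β̄·e + β·ē`, `β = x + i y`. (COPY of `DepthBoundA4.Letter`.) -/
structure Letter where
  a : ℤ
  x : ℤ
  y : ℤ
deriving DecidableEq, Repr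

/-- A cell: one letter per factor (four factors). (COPY of `DepthBoundA4.Cell`.) -/
abbrev Cell := Fin 4 → Letter

/-- `n(ν − p) = Δa² − |Δβ|²` of the difference class `ν − p` on one factor (`M² = 2n`, `χ = n`). (COPY of `SigmaH.dn`.) -/
def dn (p ν : Letter) : ℤ := (ν.a - p.a) ^ 2 - ((ν.x - p.x) ^ 2 + (ν.y - p.y) ^ 2)

/-- Mumford index of the difference class `ν − p` on one factor `E × E`: `0` ample, `2` anti-ample, `1` indefinite, `3` FLAGS degenerate.
(COPY of `SigmaH.idx`.) -/
def idx (p ν : Letter) : ℕ :=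
  if 0 < dn p ν then (if p.a < ν.a then 0 else 2) else if dn p ν < 0 then 1 else 3

/-- `dim H^{idx}(E × E, ν − p) = |χ(ν − p)| = |n|` for a non-degenerate class. (COPY of `SigmaH.hdim`.) -/
def hdim (p ν : Letter) : ℕ := (dn p ν).natAbs

/-- Künneth degree `Σ_f idx_f` on the eightfold. (COPY of `SigmaH.pairDeg`.) -/
def pairDeg (p ν : Cell) : ℕ := idx (p 0) (ν 0) + idx (p 1) (ν 1) + idx (p 2) (ν 2) + idx (p 3) (ν 3)

/-- Künneth dimension `∏_f |n_f|`. (COPY of `SigmaH.pairDim`.) -/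
def pairDim (p ν : Cell) : ℕ := hdim (p 0) (ν 0) * hdim (p 1) (ν 1) * hdim (p 2) (ν 2) * hdim (p 3) (ν 3)

/-- the degree-`d` kernel `[pairDeg = d]·pairDim`. (COPY of `SigmaH.degKer`.) -/
def degKer (d : ℕ) (x y : Cell) : ℕ := if pairDeg x y = d then pairDim x y else 0

/-! ## §1 One factor `E × E` (a surface): Serre duality flips the Mumford index `i ↦ 2 − i` -/

/-- `n(p − ν) = n(ν − p)`: the self-intersection of a difference class is even in the difference. -/
theorem dn_symm (p ν : Letter) : dn ν p = dn p ν := by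
  unfold dn; ring

/-- Off the degenerate flag the index is `0`, `1` or `2`. -/
theorem idx_le_two (p ν : Letter) (h : dn p ν ≠ 0) : idx p ν ≤ 2 := by
  unfold idx
  by_cases h1 : 0 < dn p ν
  · rw [if_pos h1]; split <;> omega
  · rw [if_neg h1]
    have h2 : dn p ν < 0 := lt_of_le_of_ne (not_lt.mp h1) h
    rw [if_pos h2]; omega

/-- A positive difference class has `Δa ≠ 0` (since `n = Δa² − |Δβ|² > 0`). -/
theorem a_ne_of_dn_pos (p ν : Letter) (h : 0 < dn p ν) : p.a ≠ ν.a := by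
  intro hpa
  unfold dn at h
  rw [hpa, sub_self] at h
  nlinarith [sq_nonneg (ν.x - p.x), sq_nonneg (ν.y - p.y)]

/-- **Serre duality, one factor.** For a non-degenerate difference class `ν − p` on `E × E` (K trivial, dim 2):
`idx(p − ν) = 2 − idx(ν − p)` — ample ↔ anti-ample, indefinite ↔ indefinite. -/
theorem idx_symm (p ν : Letter) (h : dn p ν ≠ 0) : idx ν p = 2 - idx p ν := by
  unfold idx
  rw [dn_symm p ν]
  by_cases h1 : 0 < dn p ν
  · rw [if_pos h1, if_pos h1]
    have hne := a_ne_of_dn_pos p ν h1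
    by_cases h3 : p.a < ν.a
    · have h4 : ¬ ν.a < p.a := not_lt.mpr h3.le
      rw [if_pos h3, if_neg h4]
    · have h4 : ν.a < p.a := lt_of_le_of_ne (not_lt.mp h3) (Ne.symm hne)
      rw [if_neg h3, if_pos h4]
  · have h2 : dn p ν < 0 := lt_of_le_of_ne (not_lt.mp h1) h
    rw [if_neg h1, if_neg h1, if_pos h2]

/-- `|n|` is symmetric. -/
theorem hdim_symm (p ν : Letter) : hdim ν p = hdim p ν := by
  unfold hdim; rw [dn_symm]

/-! ## §2 Four factors (the eightfold `X = (E × E)⁴`): `pairDeg ↦ 8 − pairDeg`, `pairDim` symmetric -/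

/-- Factorwise non-degenerate pair of cells (no factor difference on the flag `n = 0`). -/
def NonDeg (p ν : Cell) : Prop := ∀ f : Fin 4, dn (p f) (ν f) ≠ 0

theorem nonDeg_symm {p ν : Cell} (h : NonDeg p ν) : NonDeg ν p := by
  intro f; rw [dn_symm]; exact h f

theorem pairDim_symm (p ν : Cell) : pairDim ν p = pairDim p ν := by
  unfold pairDim
  rw [hdim_symm (p 0) (ν 0), hdim_symm (p 1) (ν 1), hdim_symm (p 2) (ν 2), hdim_symm (p 3) (ν 3)]

theorem pairDeg_le_eight (p ν : Cell) (h : NonDeg p ν) : pairDeg p ν ≤ 8 := by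
  unfold pairDeg
  have h0 := idx_le_two _ _ (h 0); have h1 := idx_le_two _ _ (h 1)
  have h2 := idx_le_two _ _ (h 2); have h3 := idx_le_two _ _ (h 3)
  omega

/-- **Serre duality in the letter calculus of record (dim X = 8).** `H^q(X, D_{pν})` and `H^{8−q}(X, D_{νp})` are dual:
the single degree carrying the cohomology of a non-degenerate difference flips `d ↦ 8 − d` when the pair is reversed. -/
theorem pairDeg_symm (p ν : Cell) (h : NonDeg p ν) : pairDeg ν p = 8 - pairDeg p ν := by
  unfold pairDeg
  have h0 := idx_le_two _ _ (h 0); have h1 := idx_le_two _ _ (h 1)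
  have h2 := idx_le_two _ _ (h 2); have h3 := idx_le_two _ _ (h 3)
  rw [idx_symm _ _ (h 0), idx_symm _ _ (h 1), idx_symm _ _ (h 2), idx_symm _ _ (h 3)]
  omega

/-- The `T₁`-partners of LAW U-VIS (`h²(D_{px}) ≠ 0`, degree 2) are exactly the pairs whose REVERSE sits in degree 6
(`h²(D_{xp}) = h⁶(D_{px})`): the `S₁`-companion of a degree-2 partner is a degree-6 datum of the same pair, not a second degree-2 datum. -/
theorem deg_two_iff_codeg_six (p x : Cell) (h : NonDeg p x) : pairDeg p x = 2 ↔ pairDeg x p = 6 := by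
  have := pairDeg_symm p x h; have := pairDeg_le_eight p x h; omega

/-- `T₂`-terms (`h¹` ALONG a two-step path or a middle-column pair): degree 1 one way is degree 7 the other way (`h¹(D)= h⁷(D^∨)`). -/
theorem deg_one_iff_codeg_seven (p x : Cell) (h : NonDeg p x) : pairDeg p x = 1 ↔ pairDeg x p = 7 := by
  have := pairDeg_symm p x h; have := pairDeg_le_eight p x h; omega

/-- `S₂`-terms (`h³` of the REVERSED pair): degree 3 reversed is degree 5 along (`h³(D^∨) = h⁵(D)`), not degree 1 along. -/
theorem deg_three_rev_iff_deg_five (p x : Cell) (h : NonDeg p x) : pairDeg x p = 3 ↔ pairDeg p x = 5 := by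
  have := pairDeg_symm p x h; have := pairDeg_le_eight p x h; omega

/-- **N2 (α) cannot hold non-trivially**: «`h³(D_{vu}) = h¹(D_{uv})`» needs `pairDeg v u = 3 ∧ pairDeg u v = 1`, i.e. `3 + 1 = 8`. -/
theorem not_deg_one_and_rev_three (p x : Cell) (h : NonDeg p x) : ¬ (pairDeg p x = 1 ∧ pairDeg x p = 3) := by
  have := pairDeg_symm p x h; have := pairDeg_le_eight p x h; omega

/-- **N2 (β) cannot hold non-trivially**: «`h²(D_{xp}) = h²(D_{px})`» for a non-degenerate pair forces both to vanish
(`2 + 2 ≠ 8`): a degree-2 visible partner is never degree-2 visible in reverse on the eightfold. -/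
theorem not_both_deg_two (p x : Cell) (h : NonDeg p x) : ¬ (pairDeg p x = 2 ∧ pairDeg x p = 2) := by
  have := pairDeg_symm p x h; have := pairDeg_le_eight p x h; omega

/-- The only self-dual degree is the middle one, `4` (where U-VIS has no term); a «fourfold» bookkeeping would make `2` self-dual. -/
theorem selfdual_deg_iff (p x : Cell) (h : NonDeg p x) : pairDeg x p = pairDeg p x ↔ pairDeg p x = 4 := by
  have := pairDeg_symm p x h; have := pairDeg_le_eight p x h; omega

/-! ## §3 The explicit digits -/

/-- `p = (0;0,0)` on factors 0–2 and `(2;1,0)` on factor 3. -/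
def pW : Cell := fun f => if f.val < 3 then ⟨0, 0, 0⟩ else ⟨2, 1, 0⟩
/-- `x = (2;1,0)` on factors 0–2 and `(0;0,0)` on factor 3: `x − p` is ample on three factors and anti-ample on one. -/
def xW : Cell := fun f => if f.val < 3 then ⟨2, 1, 0⟩ else ⟨0, 0, 0⟩

/-- `D_{px} = 𝒪(x − p)` has its cohomology in degree `2` (`h² = 3⁴ = 81`), `D_{xp} = D_{px}^∨` in degree `6` (`h⁶ = 81`, `h² = 0`):
the pair is a `T₁`-partner one way and an `S₁`-partner the other way — and `h²(D_{xp}) = 0 ≠ 81 = h²(D_{px})`. -/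
theorem witness_deg : pairDeg pW xW = 2 ∧ pairDeg xW pW = 6 ∧ pairDim pW xW = 81 ∧ pairDim xW pW = 81 := by
  decide +kernel

theorem witness_nonDeg : NonDeg pW xW := by
  intro f
  fin_cases f <;> decide +kernel

/-- In `degKer` form (the tree's `[pairDeg = d]·pairDim`): the degree-2 kernel of the pair is `81` one way and `0` the other way,
while the degree-6 kernel is `0` resp. `81` — N2 (β)'s «`h²(D_{xp}) = h²(D_{px})`» reads `0 = 81` here. -/
theorem witness_degKer : degKer 2 pW xW = 81 ∧ degKer 2 xW pW = 0 ∧ degKer 6 pW xW = 0 ∧ degKer 6 xW pW = 81 := by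
  decide +kernel

/-- A two-step ∕ middle-column pair in path degree `5`: `u = (0;0,0)⁴`, `v = ((−2;1,0), (−2;1,0), (0;1,0), (2;1,0))`
(anti-ample, anti-ample, indefinite, ample: `2 + 2 + 1 + 0 = 5`, `h⁵ = 3·3·1·3 = 27`); reversed it sits in degree `3` (`h³(D_{vu}) = 27`)
while `h¹(D_{uv}) = 0` — N2 (α)'s «`h³(D_{vu}) = h¹(D_{uv})`» reads `27 = 0` here. -/
def uW : Cell := fun _ => ⟨0, 0, 0⟩
def vW : Cell := fun f => if f.val < 2 then ⟨-2, 1, 0⟩ else if f.val = 2 then ⟨0, 1, 0⟩ else ⟨2, 1, 0⟩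

theorem witness_path : pairDeg uW vW = 5 ∧ pairDeg vW uW = 3 ∧ pairDim uW vW = 27 ∧
    degKer 1 uW vW = 0 ∧ degKer 3 vW uW = 27 ∧ degKer 5 uW vW = 27 := by
  decide +kernel

theorem witness_path_nonDeg : NonDeg uW vW := by
  intro f
  fin_cases f <;> decide +kernel

/-! ## §4 The corrected per-pair masses (arithmetic shape only)

For a homogeneous letter `x` the proof of LAW U-VIS (U-SR §4.1; ×2 UVIS-X2 §1 (a)–(d)) bounds `b₂(T_x)` by NON-CYCLE mass (`T₁`: `h²(D_{px})`;
`T₂`: `h¹` ALONG the path ∕ middle pair) PLUS BOUNDARY mass (`S₁`: `h²(D_{xp}) = h⁶(D_{px})`; `S₂`: `h³` of the REVERSED pair `= h⁵` along) —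
letter degrees `(2, 6)` for an `N₁`-partner and `(1, 5)` for an `N₂`-partner ∕ `C₂`-pair — and NOT by twice the non-cycle mass (which is what
`b₂ ≤ 2ℓ_x·M♯` of UVIS-X2 (N2) asserts).  `n1Mass` ∕ `pathMass` below are those per-pair kernels; `degKer 2` ∕ `degKer 1` are `M♯`'s summands. -/

/-- per-`N₁`-partner kernel: `h²(D_{px}) + h⁶(D_{px})` (= `T₁ + S₁` share of the pair). -/
def n1Mass (p x : Cell) : ℕ := degKer 2 p x + degKer 6 p x
/-- per-path kernel (two-step partner along the path, or middle-column pair `p → x → p′` read on `(p, p′)`): `h¹(D) + h⁵(D)` along. -/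
def pathMass (u v : Cell) : ℕ := degKer 1 u v + degKer 5 u v

/-- Under non-degeneracy the `S`-summand is a `T`-type summand of the REVERSED pair: `degKer (8 − d) p x = degKer d x p` (`d ≤ 8`). -/
theorem degKer_reverse (d : ℕ) (hd : d ≤ 8) (p x : Cell) (h : NonDeg p x) : degKer (8 - d) p x = degKer d x p := by
  unfold degKer
  rw [pairDim_symm p x]
  have hs := pairDeg_symm p x h; have hle := pairDeg_le_eight p x h
  by_cases hc : pairDeg p x = 8 - d
  · rw [if_pos hc, if_pos (by omega)]
  · rw [if_neg hc, if_neg (by omega)]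

/-- The PRINTED `N₁`-term of U-VIS, `h²(D_{px}) + h²(D_{xp})`, IS `n1Mass` (letter model, non-degenerate pair): right as printed. -/
theorem printed_N1_term (p x : Cell) (h : NonDeg p x) : degKer 2 p x + degKer 2 x p = n1Mass p x := by
  unfold n1Mass; rw [← degKer_reverse 2 (by omega) p x h]

/-- The PRINTED path ∕ middle terms, `h¹(D_{uv}) + h³(D_{vu})`, ARE `pathMass u v`: right as printed (direction-aware as in (N1)). -/
theorem printed_path_term (u v : Cell) (h : NonDeg u v) : degKer 1 u v + degKer 3 v u = pathMass u v := by
  unfold pathMass; rw [← degKer_reverse 3 (by omega) u v h]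

/-- `M♯`'s summands are the `T`-halves only: always `≤` the true per-pair kernel … -/
theorem msharp_le_n1Mass (p x : Cell) : degKer 2 p x ≤ n1Mass p x := by unfold n1Mass; omega
theorem msharp_le_pathMass (u v : Cell) : degKer 1 u v ≤ pathMass u v := by unfold pathMass; omega

/-- … and DOUBLING them does not recover it: on the witnesses `2·(M♯-summand) = 0 < 81` resp. `0 < 27` — a partner invisible to `M♯`
that feeds `S₁` resp. `S₂`.  So «`M♯(x) = 0 ⇒ x hosts only points`» and «`M♯ ≥ 7`» are NOT consequences of U-VIS's proof. -/
theorem doubling_fails : 2 * degKer 2 xW pW < n1Mass xW pW ∧ 2 * degKer 1 uW vW < pathMass uW vW := by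
  decide +kernel

theorem witness_masses : degKer 2 xW pW = 0 ∧ n1Mass xW pW = 81 ∧ degKer 1 uW vW = 0 ∧ pathMass uW vW = 27 := by
  decide +kernel

end Summit.HodgeConjecture.HodgeConjecture.Cruxes.BlochSeedDiscOne.UnipotentVisSerreFix
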